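import Summits.KontsevichZagierPeriods.KontsevichZagierPeriods.Theorems.K2SymbolChainsJensenMoveOutside
import Summits.KontsevichZagierPeriods.KontsevichZagierPeriods.Theorems.K2SymbolChainsGenericDifferentiability

/-!
# `JensenMove` (stmt-KontsevichZagierPeriods-5199, route K2SymbolChains) — proof of the crux

`JensenMove` — JENSEN IS A MOVE: over any `ℚ`-semialgebraic base `τ ⊆ ℝⁿ` with semialgebraic
weight `h` and centre `α = α₁ + iα₂` on `τ` (weight integrable against `1 + |log|α|²|`), the
unfolded torus representation `r` of `∫_τ h · J(α)`, `J(α) = ∫₀^{2π} log|e^{iφ} − α| dφ`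
(coordinates `(x, s, u)`, `e(s) = ((1 − s²) + 2is)/(1 + s²)`, `u` between `1` and
`W_α = |e(s) − α(x)|²`, integrand `±h(x)/((1 + s²)u)`) and the unfolded representation `r′` of
`∫_τ h · 2π log⁺|α|` (single sheet `1 < u < |α|²`) satisfy `[r] − [r′] ∈ KZ.relations`.

Proof: the glued split (D-0019) of the crux into its three children, all landed —
`JensenMoveDisc` (`Theorems/K2SymbolChainsJensenMoveDisc.lean`: rotation to a real centre, base
cut `{|α| < 1} ∪ {|α| = 1}`, Jensen inside by doubling + radial constancy, Jensen on the circle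
by doubling alone), `JensenMoveOutside` (`Theorems/K2SymbolChainsJensenMoveOutside.lean`:
rotation, the `log⁺` representation in normal form, signed product rule + Jensen inside for
`1/ρ`) and `GenericDifferentiability` (`Theorems/K2SymbolChainsGenericDifferentiability.lean`:
interior + piecewise smoothness of semialgebraic functions, BCR §2.9) — fed to the landed glue
`jensenMoveGlue_proof : JensenMoveDisc → JensenMoveOutside → GenericDifferentiability → JensenMove`
(`Theorems/K2SymbolChainsJensenMoveGlue.lean`: intersect the smooth loci of `α₁, α₂`, discard
the null remainder of the base and the locus `α = 0` (empty fibre), cut the rest into the regimes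
`0 < |α| ≤ 1` / `|α| > 1` by rule 1a, and note that `r′` lives over the exterior regime up to a
null set). This is the crux-strategist's sorry-free line
`Cruxes/JensenMove/Lines/jensen_move_complete.lean` re-homed under `Theorems/` piece by piece by
lead c10 of crux stmt-KontsevichZagierPeriods-9129 (banking); the same chain for an arbitrary
subgroup `S ⊇ (1a) ∪ (1b) ∪ (2)` (no Newton–Leibniz move anywhere) is the support item
`JensenIsScissors`. No new definitions.
[Jensen 1899; Kontsevich–Zagier 2001, §1.2, rules 1)–2); Bochnak–Coste–Roy 1998, §§2.2, 2.8, 2.9]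
[folklore]
-/

namespace Summit.KontsevichZagierPeriods.K2SymbolChains

/-- **JENSEN IS A MOVE** — the crux `K2SymbolChains.JensenMove` (stmt-KontsevichZagierPeriods-5199):
`[r] − [r′] ∈ KZ.relations` for the unfolded torus representation `r` of `∫_τ h · J(α)` and the
unfolded representation `r′` of `∫_τ h · 2π log⁺|α|`, over any `ℚ`-semialgebraic base with
semialgebraic weight and centre. Proof: the landed glue `jensenMoveGlue_proof` applied to the
three landed children `jensenMoveDisc_proof`, `jensenMoveOutside_proof`,
`genericDifferentiability_proof`. [Jensen 1899; Kontsevich–Zagier 2001, §1.2, rules 1)–2)]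
[folklore] -/
theorem jensenMove_proof :
    Summit.KontsevichZagierPeriods.KontsevichZagierPeriods.Theses.K2SymbolChains.JensenMove :=
  jensenMoveGlue_proof jensenMoveDisc_proof jensenMoveOutside_proof genericDifferentiability_proof

end Summit.KontsevichZagierPeriods.K2SymbolChains
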